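/-
Origin: expansion seat `planner-pub-hodgecm-pv09-g2-0`, handover v2 2026-08-18 (`HOME/pub-hodgecm-pv09-g2/lean/Pv09g2/RestrictedMeasureBorel.lean`, md5 af35c7e2, 635 lines);
landed by the gen-6 packager in gate run 22 as `HodgeCM/PerL34/RestrictedMeasureBorel.lean` (import ^import Pv[0-9]+g[0-9]+\.→import HodgeCM.PerL34. ×1).
-/
import Summits.HodgeConjecture.HodgeCM.PerL34.RestrictedMeasureHaar
import Mathlib.Topology.Algebra.RestrictedProduct.TopologicalSpace
import Mathlib.MeasureTheory.Constructions.BorelSpace.Basic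

/-!
# The σ-algebra of `RestrictedMeasure` is the BOREL σ-algebra of Mathlib's restricted-product
# topology; the restricted product measure IS a Haar measure; Haar uniqueness transfer

Fourth (additive) file of this seat.  Topology enters here for the first time.

* `measurableSet_of_isOpen`, `instMeasurableSpace_le_borel`, `borelSpace` : for countable `ι`,
  second-countable `G i` with Borel σ-algebras and measurable `K i`, the σ-algebra
  `RestrictedMeasure.instMeasurableSpace K` on `Πʳ i, [G i, K i]` (induced from the product
  σ-algebra) EQUALS the Borel σ-algebra of Mathlib's restricted-product topology
  (`RestrictedProduct.topologicalSpace`, the inductive limit of the principal levels) — so the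
  measure of `RestrictedMeasure` / `RestrictedProductMeasureDatum.ofLocal` is a Borel measure for the
  genuine restricted-product topology, not for an ad-hoc structure;
* `secondCountableTopology` : if moreover the `K i` are open, `Πʳ i, [G i, K i]` is second
  countable (countable open cover by the principal levels `A_S`);
* for open subgroups `B i` (compact off `S₀`) of second-countable Hausdorff groups and local HAAR
  measures `ν i` (Mathlib's class `IsHaarMeasure`) with `ν i (B i) = 1` off `S₀`:
  `haarCompacts` (a compact set with non-empty interior `{x | x_i ∈ C_i (i ∈ S₀), x_i ∈ B_i (i ∉ S₀)}`),
  `rpMeasure_haarBox` (its measure is `∏_{i∈S₀} ν_i(C_i) ∈ (0, ∞)`),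
  **`isHaarMeasure_rpMeasure`** (the restricted product measure is a Haar measure on the locally
  compact group `Πʳ i, [G i, B i]` in Mathlib's sense) and
  **`eq_smul_rpMeasure`**: EVERY σ-finite left-invariant Borel measure `μ'` on `Πʳ i, [G i, B i]`
  is `c • rpMeasure` with the explicit constant `c = μ'(K₀) / ∏_{i∈S₀} ν_i(C_i)` — by Mathlib's
  `Measure.haarMeasure_unique` — hence satisfies Leahy's product formula 3.1.8 / the Euler
  factorisation 3.1.9 up to the scalar `c`.  This is what makes "the" Haar measure of a paper
  (whatever its normalisation) inherit the product property proved for `rpMeasure`;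
* `rpMeasure_eq_smul` (rescaling ONE local measure inside `S₀` by `c` rescales `rpMeasure` by `c`),
  `measure_haarBox_ne_top` (such a `μ'` is automatically finite on `K₀`), `eq_rpMeasure_update`
  (so such a `μ'` IS `rpMeasure` for the local measures rescaled at one place `i₀ ∈ S₀` by
  `haarScalar μ' : ℝ≥0`), and
  **`RestrictedProductMeasureDatum.ofLeftInvariant`**: pv11's datum of `AdelicFactorisation` with
  measure field `μ := μ'` ON THE NOSE (`ofLeftInvariant_μ : _ = μ'` is `rfl`) for ANY σ-finite
  left-invariant `μ'` (no further hypothesis) — local measures `Function.update ν i₀ (c • ν i₀)`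
  (`ofLeftInvariant_ν`), same `S₀` (`ofLeftInvariant_S₀`).  Consequently pv11's
  `integrable` / `hasProd_integral` / `integral_eq_tprod` / `hEuler_of_pureTensor` apply to the
  paper's own `dg` (not only to our normalised product measure), with the single rescaled local
  factor absorbing the normalisation.

PRINT anchor (orientation only, never a hypothesis): Leahy Prop. 3.1.8 (PDF p. 89–90, printed
p. 82–83).  No internally-minted statement is cited.
Unit `pub-hodgecm-pv09-g2` (DAG-node prover #09, generation 2), 2026-08-18.  Fully kernel-checked.
-/

set_option autoImplicit false

noncomputable section

open MeasureTheory Set Filter Function Topology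

open scoped RestrictedProduct ENNReal NNReal

namespace HodgeCM.PerL34.RestrictedMeasure

universe u v

variable {ι : Type u} {G : ι → Type v} [∀ i, MeasurableSpace (G i)] [∀ i, TopologicalSpace (G i)]
  (K : ∀ i, Set (G i))

omit [∀ i, MeasurableSpace (G i)] [∀ i, TopologicalSpace (G i)] in
/-- (Ported verbatim from the HodgeCMPerL package; no docstring in the source.) -/
theorem cofinite_le_principal_compl (S : Finset ι) :
    (cofinite : Filter ι) ≤ 𝓟 ((↑S : Set ι)ᶜ) :=
  le_principal_iff.2 (by rw [mem_cofinite, compl_compl]; exact S.finite_toSet)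

/-! ## The σ-algebra is the Borel σ-algebra -/

section borel

variable [Countable ι] [∀ i, SecondCountableTopology (G i)] [∀ i, BorelSpace (G i)]

/-- Open sets of the restricted-product topology are measurable for `instMeasurableSpace K`. -/
theorem measurableSet_of_isOpen (hKm : ∀ i, MeasurableSet (K i)) {U : Set (Πʳ i, [G i, K i])}
    (hU : IsOpen U) : MeasurableSet U := by
  classical
  have hcov : (⋃ S : Finset ι, U ∩ rpBox K S) = U := by
    rw [← inter_iUnion]
    have h := iUnion_rpBox_union K (∅ : Finset ι)
    simp only [Finset.empty_union] at h
    rw [h, inter_univ]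
  rw [← hcov]
  refine MeasurableSet.iUnion fun S => ?_
  have hS := cofinite_le_principal_compl S
  obtain ⟨V, hVo, hVeq⟩ :=
    (RestrictedProduct.isEmbedding_coe_of_principal (R := fun i => G i) (A := fun i => K i)
      (S := ((↑S : Set ι)ᶜ))).isInducing.isOpen_iff.1
      (hU.preimage (RestrictedProduct.continuous_inclusion hS))
  have hUV : U ∩ rpBox K S = incl K ⁻¹' V ∩ rpBox K S := by
    ext x
    simp only [mem_inter_iff, mem_preimage]
    constructor
    · rintro ⟨hxU, hxB⟩
      let y : Πʳ i, [G i, K i]_[𝓟 ((↑S : Set ι)ᶜ)] :=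
        ⟨fun i => x i, Filter.eventually_principal.2 fun i hi => hxB i fun h => hi (Finset.mem_coe.2 h)⟩
      have hyx : RestrictedProduct.inclusion (fun i => G i) (fun i => K i) hS y = x :=
        RestrictedProduct.ext _ _ fun _ => rfl
      have hy : y ∈ RestrictedProduct.inclusion (fun i => G i) (fun i => K i) hS ⁻¹' U := by
        rw [mem_preimage, hyx]; exact hxU
      rw [← hVeq] at hy
      exact ⟨hy, hxB⟩
    · rintro ⟨hxV, hxB⟩
      let y : Πʳ i, [G i, K i]_[𝓟 ((↑S : Set ι)ᶜ)] :=
        ⟨fun i => x i, Filter.eventually_principal.2 fun i hi => hxB i fun h => hi (Finset.mem_coe.2 h)⟩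
      have hyx : RestrictedProduct.inclusion (fun i => G i) (fun i => K i) hS y = x :=
        RestrictedProduct.ext _ _ fun _ => rfl
      have hy : y ∈ ((↑) : Πʳ i, [G i, K i]_[𝓟 ((↑S : Set ι)ᶜ)] → Π i, G i) ⁻¹' V := hxV
      rw [hVeq, mem_preimage, hyx] at hy
      exact ⟨hy, hxB⟩
  rw [hUV]
  exact (hVo.measurableSet.preimage (measurable_incl K hKm)).inter (measurableSet_rpBox K hKm S)

omit [Countable ι] [∀ i, SecondCountableTopology (G i)] in
/-- The σ-algebra `instMeasurableSpace K` is contained in the Borel σ-algebra (the coordinate map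
to the full product is continuous). -/
theorem instMeasurableSpace_le_borel [Countable ι] [∀ i, SecondCountableTopology (G i)] :
    (instMeasurableSpace K : MeasurableSpace (Πʳ i, [G i, K i])) ≤ borel (Πʳ i, [G i, K i]) := by
  have h := (RestrictedProduct.continuous_coe (R := fun i => G i) (A := fun i => K i)
    (𝓕 := cofinite)).borel_measurable
  rw [← (BorelSpace.measurable_eq (α := Π i, G i))] at h
  exact measurable_iff_comap_le.1 h

/-- **Borel agreement**: `instMeasurableSpace K` IS the Borel σ-algebra of the restricted-product
topology (countable `ι`, second-countable `G i`, measurable `K i`). -/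
theorem borelSpace (hKm : ∀ i, MeasurableSet (K i)) : BorelSpace (Πʳ i, [G i, K i]) :=
  ⟨le_antisymm (instMeasurableSpace_le_borel K)
    (MeasurableSpace.generateFrom_le fun _ hU => measurableSet_of_isOpen K hKm hU)⟩

end borel

/-! ## Second countability -/

section secondCountable

variable [Countable ι] [∀ i, SecondCountableTopology (G i)]

omit [∀ i, MeasurableSpace (G i)] in
/-- For open `K i`, the restricted product of countably many second-countable spaces is second
countable (it is covered by the countably many open principal levels `A_S`). -/
theorem secondCountableTopology (hKo : ∀ i, IsOpen (K i)) :
    SecondCountableTopology (Πʳ i, [G i, K i]) := by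
  classical
  let U : Finset ι → Set (Πʳ i, [G i, K i]) := fun S =>
    Set.range (RestrictedProduct.inclusion (fun i => G i) (fun i => K i)
      (cofinite_le_principal_compl S))
  have hUo : ∀ S, IsOpen (U S) := fun S =>
    (RestrictedProduct.isOpenEmbedding_inclusion_principal hKo _).isOpen_range
  haveI hUsc : ∀ S, SecondCountableTopology (U S) := fun S => by
    haveI : SecondCountableTopology (Πʳ i, [G i, K i]_[𝓟 ((↑S : Set ι)ᶜ)]) :=
      (RestrictedProduct.isEmbedding_coe_of_principal (R := fun i => G i) (A := fun i => K i)
        (S := ((↑S : Set ι)ᶜ))).secondCountableTopology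
    exact (RestrictedProduct.isEmbedding_inclusion_principal (R := fun i => G i)
      (A := fun i => K i) (cofinite_le_principal_compl S)).toHomeomorph.symm.secondCountableTopology
  have hcov : (⋃ S, U S) = univ := by
    refine eq_univ_of_forall fun x => ?_
    have hfin : {i | ¬ (x i ∈ K i)}.Finite := Filter.eventually_cofinite.1 x.2
    refine mem_iUnion.2 ⟨hfin.toFinset, ?_⟩
    show x ∈ Set.range _
    rw [RestrictedProduct.range_inclusion]
    simp only [mem_setOf_eq, Filter.eventually_principal]
    intro i hi
    by_contra h
    exact hi (Finset.mem_coe.2 (hfin.mem_toFinset.2 h))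
  exact TopologicalSpace.secondCountableTopology_of_countable_cover hUo hcov

end secondCountable

/-! ## Coordinates of the gluing map -/

section glueApply

omit [∀ i, MeasurableSpace (G i)] [∀ i, TopologicalSpace (G i)] in
/-- (Ported verbatim from the HodgeCMPerL package; no docstring in the source.) -/
theorem glue_apply_of_mem (S : Finset ι)
    (p : ((i : {i // i ∈ S}) → G i) × ((i : {i // i ∉ S}) → K i)) {i : ι} (hi : i ∈ S) :
    glue K S p i = p.1 ⟨i, hi⟩ :=
  split_symm_apply_of_mem (G := G) S _ hi

omit [∀ i, MeasurableSpace (G i)] [∀ i, TopologicalSpace (G i)] in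
/-- (Ported verbatim from the HodgeCMPerL package; no docstring in the source.) -/
theorem glue_apply_of_not_mem (S : Finset ι)
    (p : ((i : {i // i ∈ S}) → G i) × ((i : {i // i ∉ S}) → K i)) {i : ι} (hi : i ∉ S) :
    glue K S p i = (p.2 ⟨i, hi⟩ : G i) :=
  split_symm_apply_of_not_mem (G := G) S _ hi

end glueApply

end HodgeCM.PerL34.RestrictedMeasure

/-! ## Groups: the restricted product measure is a Haar measure; Haar uniqueness transfer -/

namespace HodgeCM.PerL34.RestrictedMeasure

universe u v

variable {ι : Type u} {G : ι → Type v} [∀ i, Group (G i)] [∀ i, TopologicalSpace (G i)]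
  [∀ i, IsTopologicalGroup (G i)] [∀ i, T2Space (G i)] [∀ i, SecondCountableTopology (G i)]
  [∀ i, MeasurableSpace (G i)] [∀ i, BorelSpace (G i)] [Countable ι]
  (B : ∀ i, Subgroup (G i)) [hBo : Fact (∀ i, IsOpen (B i : Set (G i)))]
  (S₀ : Finset ι) (C : ∀ i, TopologicalSpace.PositiveCompacts (G i))

/-- The reference compact set `K₀ = {x | x_i ∈ C_i (i ∈ S₀), x_i ∈ B_i (i ∉ S₀)}`. -/
def haarBox : Set (Πʳ i, [G i, B i]) :=
  {x | (∀ i, i ∈ S₀ → x i ∈ (C i : Set (G i))) ∧ ∀ i, i ∉ S₀ → x i ∈ (B i : Set (G i))}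

omit [∀ i, IsTopologicalGroup (G i)] [∀ i, T2Space (G i)] [∀ i, SecondCountableTopology (G i)]
  [∀ i, MeasurableSpace (G i)] [∀ i, BorelSpace (G i)] [Countable ι] hBo in
/-- (Ported verbatim from the HodgeCMPerL package; no docstring in the source.) -/
theorem haarBox_subset_rpBox : haarBox B S₀ C ⊆ rpBox (fun i => (B i : Set (G i))) S₀ :=
  fun _ hx => hx.2

omit [∀ i, IsTopologicalGroup (G i)] [∀ i, T2Space (G i)] [∀ i, SecondCountableTopology (G i)]
  [∀ i, MeasurableSpace (G i)] [∀ i, BorelSpace (G i)] [Countable ι] hBo in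
/-- (Ported verbatim from the HodgeCMPerL package; no docstring in the source.) -/
theorem isCompact_haarBox (hBc : ∀ i, i ∉ S₀ → IsCompact (B i : Set (G i))) :
    IsCompact (haarBox B S₀ C) := by
  classical
  have hS := cofinite_le_principal_compl S₀
  let Q : Set (Π i, G i) := univ.pi fun i => if i ∈ S₀ then (C i : Set (G i)) else (B i : Set (G i))
  have hQc : IsCompact Q := isCompact_univ_pi fun i => by
    by_cases hi : i ∈ S₀
    · simp only [hi, if_true]; exact (C i).isCompact
    · simp only [hi, if_false]; exact hBc i hi
  have hQr : Q ⊆ range ((↑) : Πʳ i, [G i, B i]_[𝓟 ((↑S₀ : Set ι)ᶜ)] → Π i, G i) := by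
    intro f hf
    rw [RestrictedProduct.range_coe_principal]
    intro i hi
    have hi' : i ∉ S₀ := fun h => hi (Finset.mem_coe.2 h)
    have := hf i (mem_univ i)
    simp only [hi', if_false] at this
    exact this
  have h1 : IsCompact (((↑) : Πʳ i, [G i, B i]_[𝓟 ((↑S₀ : Set ι)ᶜ)] → Π i, G i) ⁻¹' Q) :=
    ((RestrictedProduct.isEmbedding_coe_of_principal (R := fun i => G i)
      (A := fun i => (B i : Set (G i))) (S := ((↑S₀ : Set ι)ᶜ))).isInducing.isCompact_preimage_iff
      hQr).2 hQc
  have h2 := h1.image (RestrictedProduct.continuous_inclusion hS)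
  convert h2 using 1
  ext x
  constructor
  · rintro ⟨hC, hB⟩
    refine ⟨⟨fun i => x i, Filter.eventually_principal.2 fun i hi => hB i fun h => hi (Finset.mem_coe.2 h)⟩,
      ?_, RestrictedProduct.ext _ _ fun _ => rfl⟩
    intro i _
    by_cases hi : i ∈ S₀
    · simp only [hi, if_true]; exact hC i hi
    · simp only [hi, if_false]; exact hB i hi
  · rintro ⟨y, hy, rfl⟩
    refine ⟨fun i hi => ?_, fun i hi => ?_⟩
    · have := hy i (mem_univ i)
      simp only [hi, if_true] at this
      exact this
    · have := hy i (mem_univ i)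
      simp only [hi, if_false] at this
      exact this

omit [∀ i, IsTopologicalGroup (G i)] [∀ i, T2Space (G i)] [∀ i, SecondCountableTopology (G i)]
  [∀ i, MeasurableSpace (G i)] [∀ i, BorelSpace (G i)] [Countable ι] in
/-- (Ported verbatim from the HodgeCMPerL package; no docstring in the source.) -/
theorem haarBox_interior_nonempty : (interior (haarBox B S₀ C)).Nonempty := by
  classical
  let W : Set (Πʳ i, [G i, B i]) :=
    {x | ∀ i, i ∉ S₀ → x.1 i ∈ (B i : Set (G i))} ∩
      ⋂ i ∈ S₀, (fun x : Πʳ i, [G i, B i] => x i) ⁻¹' interior (C i : Set (G i))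
  have hWo : IsOpen W :=
    (RestrictedProduct.isOpen_forall_imp_mem hBo.out).inter
      (isOpen_biInter_finset fun i _ => isOpen_interior.preimage (RestrictedProduct.continuous_eval i))
  have hWK : W ⊆ haarBox B S₀ C := fun x hx =>
    ⟨fun i hi => interior_subset (mem_iInter₂.1 hx.2 i hi), hx.1⟩
  have hc : ∀ i, ∃ g, g ∈ interior (C i : Set (G i)) := fun i => (C i).interior_nonempty
  choose g hg using hc
  have hev : ∀ᶠ i in cofinite, (fun i => if i ∈ S₀ then g i else (1 : G i)) i ∈ (B i : Set (G i)) :=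
    Filter.eventually_cofinite.2 (S₀.finite_toSet.subset fun i hi => by
      by_contra h
      refine hi ?_
      show (if i ∈ S₀ then g i else (1 : G i)) ∈ (B i : Set (G i))
      rw [if_neg (fun h' => h (Finset.mem_coe.2 h'))]
      exact (B i).one_mem)
  let x : Πʳ i, [G i, B i] := ⟨fun i => if i ∈ S₀ then g i else 1, hev⟩
  refine ⟨x, interior_mono hWK ?_⟩
  rw [hWo.interior_eq]
  refine ⟨fun i hi => ?_, mem_iInter₂.2 fun i hi => ?_⟩
  · show (if i ∈ S₀ then g i else (1 : G i)) ∈ (B i : Set (G i))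
    rw [if_neg hi]; exact (B i).one_mem
  · show (if i ∈ S₀ then g i else (1 : G i)) ∈ interior (C i : Set (G i))
    rw [if_pos hi]; exact hg i

/-- `K₀` as a compact set with non-empty interior of the restricted product group. -/
def haarCompacts (hBc : ∀ i, i ∉ S₀ → IsCompact (B i : Set (G i))) :
    TopologicalSpace.PositiveCompacts (Πʳ i, [G i, B i]) :=
  ⟨⟨haarBox B S₀ C, isCompact_haarBox B S₀ C hBc⟩, haarBox_interior_nonempty B S₀ C⟩

omit [∀ i, IsTopologicalGroup (G i)] [∀ i, SecondCountableTopology (G i)] [∀ i, BorelSpace (G i)] in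
/-- (Ported verbatim from the HodgeCMPerL package; no docstring in the source.) -/
theorem measurableSet_haarBox [∀ i, OpensMeasurableSpace (G i)] :
    MeasurableSet (haarBox B S₀ C) := by
  have hBm : ∀ i, MeasurableSet (B i : Set (G i)) := fun i => (hBo.out i).measurableSet
  have h1 : MeasurableSet {x : Πʳ i, [G i, B i] | ∀ i, i ∈ S₀ → x i ∈ (C i : Set (G i))} := by
    have : {x : Πʳ i, [G i, B i] | ∀ i, i ∈ S₀ → x i ∈ (C i : Set (G i))} =
        ⋂ i ∈ S₀, (fun x : Πʳ i, [G i, B i] => x i) ⁻¹' (C i : Set (G i)) := by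
      ext x; simp only [mem_setOf_eq, mem_iInter, mem_preimage]
    rw [this]
    exact MeasurableSet.biInter S₀.countable_toSet fun i _ =>
      (C i).isCompact.measurableSet.preimage
        ((measurable_pi_apply i).comp (measurable_incl (fun i => (B i : Set (G i))) hBm))
  exact h1.inter (measurableSet_rpBox _ hBm S₀)

variable (ν : ∀ i, Measure (G i)) [∀ i, SigmaFinite (ν i)]

omit [∀ i, IsTopologicalGroup (G i)] [∀ i, SecondCountableTopology (G i)] [∀ i, BorelSpace (G i)] in
/-- The measure of `K₀` is the finite positive number `∏_{i∈S₀} ν_i(C_i)`. -/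
theorem rpMeasure_haarBox [∀ i, OpensMeasurableSpace (G i)]
    (hB1 : ∀ i, i ∉ S₀ → ν i (B i : Set (G i)) = 1) :
    rpMeasure (fun i => (B i : Set (G i))) ν S₀ (haarBox B S₀ C) =
      ∏ i : {i // i ∈ S₀}, ν i (C i : Set (G i)) := by
  have hKne : ∀ i, ((B i : Set (G i))).Nonempty := fun i => ⟨1, (B i).one_mem⟩
  have hBm : ∀ i, MeasurableSet (B i : Set (G i)) := fun i => (hBo.out i).measurableSet
  haveI := isProbabilityMeasure_rho (fun i => (B i : Set (G i))) ν hKne hBm S₀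
  have hpre : glue (fun i => (B i : Set (G i))) S₀ ⁻¹' haarBox B S₀ C =
      (univ.pi fun i : {i // i ∈ S₀} => (C i : Set (G i))) ×ˢ univ := by
    ext p
    simp only [mem_preimage, haarBox, mem_setOf_eq, mem_prod, mem_univ_pi, mem_univ, and_true]
    constructor
    · rintro ⟨hC, -⟩ j
      have := hC j j.2
      rwa [glue_apply_of_mem (fun i => (B i : Set (G i))) S₀ p j.2] at this
    · intro hy
      refine ⟨fun i hi => ?_, fun i hi => ?_⟩
      · rw [glue_apply_of_mem (fun i => (B i : Set (G i))) S₀ p hi]; exact hy ⟨i, hi⟩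
      · rw [glue_apply_of_not_mem (fun i => (B i : Set (G i))) S₀ p hi]; exact (p.2 ⟨i, hi⟩).2
  rw [← inter_eq_left.2 (haarBox_subset_rpBox B S₀ C),
    ← Measure.restrict_apply' (measurableSet_rpBox _ hBm S₀),
    rpMeasure_restrict_rpBox _ ν hKne hBm hB1 (Finset.Subset.refl S₀),
    Measure.map_apply (measurable_glue _ hBm S₀) (measurableSet_haarBox B S₀ C), hpre,
    Measure.prod_prod, measure_univ, mul_one, Measure.pi_pi]

variable [∀ i, (ν i).IsHaarMeasure]

omit [∀ i, IsTopologicalGroup (G i)] [∀ i, T2Space (G i)] [∀ i, SecondCountableTopology (G i)]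
  [∀ i, BorelSpace (G i)] [Countable ι] hBo [∀ i, SigmaFinite (ν i)] in
/-- (Ported verbatim from the HodgeCMPerL package; no docstring in the source.) -/
theorem prod_haar_ne_zero : (∏ i : {i // i ∈ S₀}, ν i (C i : Set (G i))) ≠ 0 :=
  Finset.prod_ne_zero_iff.2 fun i _ =>
    (Measure.measure_pos_of_nonempty_interior (ν i) (C (i : ι)).interior_nonempty).ne'

omit [∀ i, IsTopologicalGroup (G i)] [∀ i, SecondCountableTopology (G i)] [∀ i, BorelSpace (G i)]
  [Countable ι] hBo [∀ i, SigmaFinite (ν i)] [∀ i, T2Space (G i)] in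
/-- (Ported verbatim from the HodgeCMPerL package; no docstring in the source.) -/
theorem prod_haar_ne_top : (∏ i : {i // i ∈ S₀}, ν i (C i : Set (G i))) ≠ ∞ :=
  ENNReal.prod_ne_top fun i _ => (C (i : ι)).isCompact.measure_lt_top.ne

include C in
/-- **The restricted product of local Haar measures is a HAAR MEASURE** (Mathlib's class) on the
locally compact, second countable group `Πʳ i, [G i, B i]` — for open subgroups `B i`, compact off
`S₀`, normalising `ν i (B i) = 1` off `S₀` (`C`: any choice of compact sets with non-empty interior
in the `G i`, used only in the proof). -/
theorem isHaarMeasure_rpMeasure (hBc : ∀ i, i ∉ S₀ → IsCompact (B i : Set (G i)))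
    (hB1 : ∀ i, i ∉ S₀ → ν i (B i : Set (G i)) = 1) :
    (rpMeasure (fun i => (B i : Set (G i))) ν S₀).IsHaarMeasure := by
  have hBm : ∀ i, MeasurableSet (B i : Set (G i)) := fun i => (hBo.out i).measurableSet
  haveI : BorelSpace (Πʳ i, [G i, B i]) := borelSpace (fun i => (B i : Set (G i))) hBm
  haveI : SecondCountableTopology (Πʳ i, [G i, B i]) :=
    secondCountableTopology (fun i => (B i : Set (G i))) hBo.out
  haveI := sigmaFinite_rpMeasure (fun i => (B i : Set (G i))) ν hBm (S₀ := S₀) hB1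
  haveI := isMulLeftInvariant_rpMeasure B ν hBm hB1
  have h2 := Measure.haarMeasure_unique (rpMeasure (fun i => (B i : Set (G i))) ν S₀)
    (haarCompacts B S₀ C hBc)
  have ha : rpMeasure (fun i => (B i : Set (G i))) ν S₀ (haarCompacts B S₀ C hBc) =
      ∏ i : {i // i ∈ S₀}, ν i (C i : Set (G i)) := rpMeasure_haarBox B S₀ C ν hB1
  rw [ha] at h2
  rw [h2]
  exact Measure.IsHaarMeasure.smul _ (prod_haar_ne_zero S₀ C ν) (prod_haar_ne_top S₀ C ν)


-- port_pkg: scope closed for this part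
end HodgeCM.PerL34.RestrictedMeasure
end
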